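import Summits.QuantumFields.BalabanUV.Beta.D1BFx.GhostLegWardRooted
import Summits.QuantumFields.BalabanUV.Beta.D1BFx.GhostStencilRootedReflection
import Summits.QuantumFields.BalabanUV.Beta.D1BFx.FineHessianWard

/-!
# `BalabanUV.Beta.D1BFx.GhostAveragingSquare` — road «BF-x» for binder row D1, sub-leaf T6-Q₂: THE SECOND-ORDER AVERAGING TABLE
# OF THE GHOST SECTOR (the `Q′(U)` second jets OWED since T6 v1), ITS WARD LAW (W2-Q), THE COMPLETED TWO-BOND GHOST TABLE `WghAt`, AND
# THE GHOST-SECTOR WARD ROWS `hrow` AS A THEOREM — whence node R5 / A4 (`X_n = 0`) for the completed, centre-rooted ghost data with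
# NO hypothesis beyond `Odd n`, `0 < a`

HONEST DEPENDENCY (page 1, mandatory): continuum YM on T⁴ ⇐ BetaPertH ∧ nine spine estimates (0/9 proved); BetaPertH ⇐ (D1) ∧ (D4) ∧
CAP+tail; G-an2-4 gates asym, D1 and NE2/3/4.  HONEST FRAMING (cell contract, verbatim): «discharging `BetaPertH` makes Bałaban's UV
stability UNCONDITIONAL — a real constructive-QFT result; it is NOT the continuum limit and NOT the Clay problem.»  THIS MODULE DISCHARGES
NOTHING of the wall: two definitions with bodies ([our object] `qSqAt`, `WghAt`) and [folklore] kernel bookkeeping BY NAME over the tree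
(`GhostStencilRooted.qAntiAt`/`SghAt`/`biLoc_qAntiAt`/`qAntiAt_translate`/`biLoc_SghAt`/`SghAt_translate_block`, `GhostLegWardRooted.div_qAntiAt_apply`/
`ward₁_Ggh_rooted`, `GhostStencilWard.genX`/`ward₂_ghX`, `GhostStencilReflection.ghX`/`smul_ghX_pointInversion`, `GhostStencilRootedReflection.
qAntiAt_ctr_reflect_apply`/`SghAt_pointInversion`, `GhostLegReflection.refK_invLeg_Ggh`, `ReducedKernelSandwichBlock.diagExt`,
`FineHessianReflection.diagExt_refl`, `FineHessianWard.hasSum_row_fineHessA_of_wardLaws`/`bondSecondMoment_TOfLeg_eq_avgM2_of_laws`).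
No `def … : Prop`, no citation, no printed statement as hypothesis; 0 binders of the hR root touched; NOT summit progress.
ABSOLUTE RULE (cell charter, verbatim): «No internally-minted statement may enter as a cited fact. Every hypothesis is either
kernel-proved in this package or a verbatim quotation of a PUBLISHED theorem with page reference. The manuscript(s) under audit are NOT
citable for their own disputed steps — they are the thing under adjudication; programme-internal (2001/route/tribunal) claims are never
citable.»

WHY (typer LEAVES §D «owed trivia under scope v1: `GhostStencil` Q′(U) second jets»; OWNER RULINGS #1 R-4 (iii)/(iv); the scope notes of
leaf-04-g2's T7-gh v1.1 and this seat, journal 2026-08-20 l.12266/l.12277).  The A4/K-R5 ENDs of the ghost sector take the Ward ROW SUMS `hrow` of the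
fine ghost Hessian kernel; `FineHessianWard` reduces `hrow` to the jet laws (W1)/(W2).  (W1) is leaf-01-g3's `ward₁_Ggh_rooted` on the ray
`(cK, cQ) = c·(n², a)` with `X u = (−c) • genX u`; (W2) against the SAME stencil needs, besides `ward₂_ghX` for the current part, a table
whose first-bond divergence is the commutator `genX u ∘ qAntiAt ρ n λ′ u′ − qAntiAt ρ n λ′ u′ ∘ genX u` of the AVERAGING part — absent from
T6 v1/v1.1 (`Wgh`, `diagExt (ghXTab)` are bond-diagonal).  THE TABLE: `qSqAt ρ n κ′ u λ′ u′ (x, z) := qAntiAt ρ n κ′ u (x, z) · qAntiAt ρ n λ′ u′ (x, z)`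
(pointwise product).  MODEL READING (pen-and-paper, NOT a theorem here; identification with Bałaban's normalisation is the owner's CHECK-N0 /
K-R1 like every T-object): with `Q′(U)(y, x) = n⁻⁴·[x ∈ B(y)]·Ad Hol(Γ_{ny+ρ, x})` and `Hol₂ = ½(Σ_b γ_b ad B_b)² + ½·commSum`
(the two terms of `AdjointTransportJets.D₂_zero`), the degree-two part of `η·Q′(U)*aQ′(U)` in the order-blind symmetric colour unit of `ghX`
(`AᵀA′`, transposition flipping one `ad`) is `−½·a·n⁴·(qAntiAt ⊗ qAntiAt)` per ordered bond pair, i.e. the Hessian-convention table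
`−a·n⁴·qSqAt`; the `commSum` part carries the ANTISYMMETRIC colour structure `f_{cde} ad_e` and has no image in the `Unit`-fibre currency
(scope caveat, as for `ghX`).  What IS proved: the Ward law (W2-Q) — which is all `hrow` consumes — and the sockets.

CONTENT.
* §1 [our object] `qSqAt`; [folklore] `qSqAt_swap`, `qSqAt_symm`, `biLoc_qSqAt` (rate `δ/n`, constant `((8/n³)e^{8δ})²`), `qSqAt_translate`
  (block vectors), `qSqAt_pointInversion` (centre root, odd `n`, signs `(−1)·(−1)` — the END's `hWr` shape).
* §2 [folklore] **(W2-Q) `divW_smul_qSqAt`**: `divW (w • qSqAt ρ n) u λ′ u′ = (−(w/n⁴)) • (genX u ∘ qAntiAt ρ n λ′ u′ − qAntiAt ρ n λ′ u′ ∘ genX u)`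
  (every in-block root); [our object] `WghAt ρ n x₀ cK cQ := diagExt ((x₀·cK) • ghX) + (−(x₀·cQ·n⁴)) • qSqAt ρ n`; [folklore]
  **`ward₂_WghAt`**: `divW (WghAt ρ n x₀ cK cQ) u λ′ u′ = (x₀ • genX u) ∘ SghAt ρ n cK cQ λ′ u′ − SghAt ρ n cK cQ λ′ u′ ∘ (x₀ • genX u)` for ALL
  real `x₀ cK cQ`; sockets `biLoc_WghAt`, `WghAt_symm`, `WghAt_translate`, `WghAt_pointInversion`.
* §3 [folklore] the ENDs BY NAME: **`hasSum_row_fineHessA_ghost`** (`hrow` for `(Ggh n a, SghAt ρ n (c·n²) (c·a), WghAt ρ n (−c) (c·n²) (c·a))`,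
  every in-block root, `0 < a`, every real `c`) and **`bondSecondMoment_TOfGh_eq_avgM2_ghost`** (centre root, `Odd n`, `0 < a`: the coarse
  bond second moment of the completed ghost fine kernel is the block average of the fine one — NO other hypothesis).
Unit `b2b-balaban-beta-d1-formalise-leaf-02` (gen 2).
-/

noncomputable section

namespace Summit.QuantumFields.BalabanUV.Beta.D1BFx.GhostAveragingSquare

open Finset
open scoped BigOperators
open Literature.MathematicalPhysics.QuantumFieldTheory.Balaban1983to89
open Literature.MathematicalPhysics.QuantumFieldTheory.Balaban1983to89.Beta
open B12Sec2to5 (l1 l1_nonneg)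
open B6QGQLower276 (blk sameBlk)
open ExpKernelCalculus (Site MKer BiLoc shiftK comp)
open AffineAveraging (unitVec)
open KernelReflection (LegMap refK refK_apply)
open KernelWard (divW biLoc_add)
open Summit.QuantumFields.BalabanUV.Beta.D1BFx.GhostLeg (Ggh spr_Ggh shiftK_Ggh_neg)
open Summit.QuantumFields.BalabanUV.Beta.D1BFx.GhostStencil (ghCur ghCur_apply)
open Summit.QuantumFields.BalabanUV.Beta.D1BFx.GhostStencilRooted (qJetAt qAntiAt qAntiAt_apply qAntiAt_antisymm SghAt SghAt_apply
  biLoc_qAntiAt qAntiAt_translate qJetAt_eq_zero biLoc_SghAt SghAt_translate_block)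
open Summit.QuantumFields.BalabanUV.Beta.D1BFx.GhostStencilWard (genX genX_apply comp_genX_left comp_genX_right unitVec_eq ward₂_ghX
  Sgh_zero_eq comp_smul_right' comp_smul_left')
open Summit.QuantumFields.BalabanUV.Beta.D1BFx.GhostStencilReflection (ghX ghX_apply ghX_symm ghX_translate biLoc_ghX ctrVec cInv
  refK_invLeg_apply refK_smul refK_add smul_ghX_pointInversion)
open Summit.QuantumFields.BalabanUV.Beta.D1BFx.GhostStencilRootedReflection (ctrHalf ctrHalf_mem qAntiAt_ctr_reflect_apply SghAt_pointInversion)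
open Summit.QuantumFields.BalabanUV.Beta.D1BFx.GhostLegReflection (invLeg refK_invLeg_Ggh)
open Summit.QuantumFields.BalabanUV.Beta.D1BFx.GhostLegWard (biLoc_smul_genX)
open Summit.QuantumFields.BalabanUV.Beta.D1BFx.GhostLegWardRooted (div_qAntiAt_apply ward₁_Ggh_rooted)
open Summit.QuantumFields.BalabanUV.Beta.D1BFx.GhostKernel (biLoc_smul' shiftK_smul)
open Summit.QuantumFields.BalabanUV.Beta.D1BFx.ReducedKernelF (TOfLeg TOfGh)
open Summit.QuantumFields.BalabanUV.Beta.D1BFx.ReducedTableF (tableRedF)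
open Summit.QuantumFields.BalabanUV.Beta.D1BFx.MomentTransferPeriodicEntry (avgM2)
open Summit.QuantumFields.BalabanUV.Beta.D1BFx.ReducedKernelSandwichLeg (fineHessA)
open Summit.QuantumFields.BalabanUV.Beta.D1BFx.ReducedKernelSandwichBlock (diagExt diagExt_apply diagExt_symm biLoc_diagExt diagExt_translate)
open Summit.QuantumFields.BalabanUV.Beta.D1BFx.FineHessianReflection (diagExt_refl)
open Summit.QuantumFields.BalabanUV.Beta.D1BFx.FineHessianWard (hasSum_row_fineHessA_of_wardLaws bondSecondMoment_TOfLeg_eq_avgM2_of_laws)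

/-! ## §1 The square of the averaging jet -/

/-- [our object] **THE SECOND-ORDER AVERAGING TABLE OF THE GHOST SECTOR** (root `ρ`, blocking `n`, fine bonds `(κ′, u)`, `(λ′, u′)`):
the POINTWISE product of the two stripped first averaging jets, `qSqAt ρ n κ′ u λ′ u′ (x, z) := qAntiAt ρ n κ′ u (x, z) · qAntiAt ρ n λ′ u′ (x, z)`.
The colour weight (model reading: `−a·n⁴` in `ghX`'s unit) is EXTERNAL.  A DEFINITION; asserts nothing; NOT claimed to be Bałaban's (CHECK-N0). -/
def qSqAt (ρ : Site 4) (n : ℕ) (κ' : Fin 4) (u : Site 4) (l' : Fin 4) (u' : Site 4) : MKer 4 Unit := fun x z _ _ =>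
  qAntiAt ρ n κ' u x z () () * qAntiAt ρ n l' u' x z () ()

variable (ρ : Site 4) (n : ℕ) (κ' : Fin 4) (u : Site 4) (l' : Fin 4) (u' : Site 4)

/-- [our object] Unfolding `qSqAt`. -/
theorem qSqAt_apply (x z : Site 4) (a b : Unit) :
    qSqAt ρ n κ' u l' u' x z a b = qAntiAt ρ n κ' u x z () () * qAntiAt ρ n l' u' x z () () := rfl

/-- [folklore] BOND-SWAP SYMMETRY (the END's `hWsymm` shape): `qSqAt ρ n κ′ u λ′ u′ = qSqAt ρ n λ′ u′ κ′ u`. -/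
theorem qSqAt_swap : qSqAt ρ n κ' u l' u' = qSqAt ρ n l' u' κ' u := by
  funext x z a b
  rw [qSqAt_apply, qSqAt_apply, mul_comm]

/-- [folklore] LEG SYMMETRY: the product of two antisymmetric kernels is symmetric, `qSqAt … z x b a = qSqAt … x z a b`. -/
theorem qSqAt_symm (x z : Site 4) (a b : Unit) : qSqAt ρ n κ' u l' u' z x b a = qSqAt ρ n κ' u l' u' x z a b := by
  rw [qSqAt_apply, qSqAt_apply, qAntiAt_antisymm ρ n κ' u x z () (), qAntiAt_antisymm ρ n l' u' x z () ()]
  ring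

/-- [folklore] Off the common block the averaging jet vanishes: `blk x ≠ blk z → qAntiAt ρ n κ′ u x z = 0`. -/
theorem qAntiAt_eq_zero_of_blk_ne {x z : Site 4} (h : blk (n - 1) x ≠ blk (n - 1) z) (a b : Unit) : qAntiAt ρ n κ' u x z a b = 0 := by
  rw [qAntiAt_apply, qJetAt_eq_zero ρ n κ' u (fun hh => h hh.1.symm), qJetAt_eq_zero ρ n κ' u (fun hh => h hh.1), sub_zero]

variable [NeZero n]

/-- [folklore] **LOCALISATION SOCKET** (in-block root): `BiLoc (qSqAt ρ n κ′ u λ′ u′) u u′ (((8/n³)·e^{8δ})²) (δ/n)` for every `δ ≥ 0` —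
the two factors' one-block supports (`biLoc_qAntiAt`) give decay from `u` in the first leg and from `u′` in the second. -/
theorem biLoc_qSqAt {ρ : Site 4} (hρ : ∀ i : Fin 4, 0 ≤ ρ i ∧ ρ i < n) {δ : ℝ} (hδ : 0 ≤ δ) :
    BiLoc (qSqAt ρ n κ' u l' u') u u' ((8 / (n : ℝ) ^ 3 * Real.exp (8 * δ)) ^ 2) (δ / n) := by
  have hn : (0 : ℝ) ≤ n := Nat.cast_nonneg n
  intro x z a b
  have h1 := biLoc_qAntiAt n κ' u hρ hδ x z () ()
  have h2 := biLoc_qAntiAt n l' u' hρ hδ x z () ()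
  rw [qSqAt_apply, abs_mul]
  have hC : 0 ≤ 8 / (n : ℝ) ^ 3 * Real.exp (8 * δ) := by positivity
  calc |qAntiAt ρ n κ' u x z () ()| * |qAntiAt ρ n l' u' x z () ()|
      ≤ (8 / (n : ℝ) ^ 3 * Real.exp (8 * δ) * Real.exp (-(δ / n) * (l1 (x - u) + l1 (z - u)))) *
        (8 / (n : ℝ) ^ 3 * Real.exp (8 * δ) * Real.exp (-(δ / n) * (l1 (x - u') + l1 (z - u')))) :=
        mul_le_mul h1 h2 (abs_nonneg _) ((abs_nonneg _).trans h1)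
    _ = (8 / (n : ℝ) ^ 3 * Real.exp (8 * δ)) ^ 2 *
        Real.exp (-(δ / n) * (l1 (x - u) + l1 (z - u)) + -(δ / n) * (l1 (x - u') + l1 (z - u'))) := by
        rw [Real.exp_add]; ring
    _ ≤ (8 / (n : ℝ) ^ 3 * Real.exp (8 * δ)) ^ 2 * Real.exp (-(δ / n) * (l1 (x - u) + l1 (z - u'))) := by
        refine mul_le_mul_of_nonneg_left (Real.exp_le_exp.2 ?_) (by positivity)
        have ha := l1_nonneg (z - u)
        have hb := l1_nonneg (x - u')
        have hδn : 0 ≤ δ / n := div_nonneg hδ hn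
        nlinarith

/-- [folklore] **BLOCK-TRANSLATION COVARIANCE** (any root; the END's `hWcov` shape):
`qSqAt ρ n κ′ (u + n•t) λ′ (u′ + n•t) = shiftK (−n•t) (qSqAt ρ n κ′ u λ′ u′)`. -/
theorem qSqAt_translate (t : Site 4) :
    qSqAt ρ n κ' (u + (n : ℤ) • t) l' (u' + (n : ℤ) • t) = shiftK (-((n : ℤ) • t)) (qSqAt ρ n κ' u l' u') := by
  funext x z a b
  rw [qSqAt_apply, qAntiAt_translate, qAntiAt_translate]
  rfl

/-- [folklore] **INVERSION LAW AT THE CENTRED ROOT** (odd `n`; the END's `hWr` shape with the stencil's data `(invLeg n, cInv n, σ ≡ −1)`):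
`qSqAt c n κ′ (cInv n κ′ − u) λ′ (cInv n λ′ − u′) = ((−1)·(−1)) • refK (invLeg n) (qSqAt c n κ′ u λ′ u′)`, `c = ctrHalf n`. -/
theorem qSqAt_pointInversion (hodd : Odd n) :
    qSqAt (ctrHalf n) n κ' (cInv n κ' - u) l' (cInv n l' - u')
      = ((-1 : ℝ) * (-1)) • refK (invLeg n) (qSqAt (ctrHalf n) n κ' u l' u') := by
  funext x z a b
  have h1 := qAntiAt_ctr_reflect_apply n hodd κ' u x z () ()
  have h2 := qAntiAt_ctr_reflect_apply n hodd l' u' x z () ()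
  rw [Pi.smul_apply, Pi.smul_apply, Pi.smul_apply, Pi.smul_apply, smul_eq_mul, refK_invLeg_apply, qSqAt_apply, qSqAt_apply, h1, h2]
  ring

/-! ## §2 The Ward law (W2-Q) and the completed two-bond ghost table -/

/-- [folklore] The first-bond divergence is additive in the table (entrywise). -/
theorem divW_add_apply (W₁ W₂ : Fin 4 → Site 4 → Fin 4 → Site 4 → MKer 4 Unit) (y : Site 4) (ν : Fin 4) (y' x z : Site 4) (a b : Unit) :
    divW (fun κ v l v' => W₁ κ v l v' + W₂ κ v l v') y ν y' x z a b = divW W₁ y ν y' x z a b + divW W₂ y ν y' x z a b := by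
  unfold divW
  simp only [Finset.sum_apply, Pi.add_apply, Pi.sub_apply, ← Finset.sum_add_distrib]
  exact Finset.sum_congr rfl fun μ _ => by ring

/-- [folklore] **(W2-Q) — THE WARD LAW OF THE SQUARED AVERAGING JET** (every in-block root `ρ`, every real weight `w`):
`divW (w • qSqAt ρ n) u λ′ u′ = (−(w/n⁴)) • (genX u ∘ qAntiAt ρ n λ′ u′ − qAntiAt ρ n λ′ u′ ∘ genX u)`.
Three lines over `GhostLegWardRooted.div_qAntiAt_apply` (the divergence of the first factor is `n⁻⁴·(sameBlk x u·[z = u] − [x = u]·sameBlk u z)`;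
the `sameBlk` guards are absorbed by the second factor's one-block support). -/
theorem divW_smul_qSqAt {ρ : Site 4} (hρ : ∀ i : Fin 4, 0 ≤ ρ i ∧ ρ i < n) (w : ℝ) (y : Site 4) (l' : Fin 4) (u' : Site 4) :
    divW (fun κ v l v' => w • qSqAt ρ n κ v l v') y l' u'
      = (-(w / (n : ℝ) ^ 4)) • (comp (genX y) (qAntiAt ρ n l' u') - comp (qAntiAt ρ n l' u') (genX y)) := by
  have hn : (n : ℝ) ≠ 0 := by exact_mod_cast NeZero.ne n
  funext x z a b
  obtain rfl : a = () := Subsingleton.elim _ _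
  obtain rfl : b = () := Subsingleton.elim _ _
  unfold divW
  rw [Finset.sum_apply, Finset.sum_apply, Finset.sum_apply, Finset.sum_apply]
  simp only [Pi.sub_apply, Pi.smul_apply, smul_eq_mul, qSqAt_apply, unitVec_eq, comp_genX_left, comp_genX_right]
  have hre : ∀ μ : Fin 4, w * (qAntiAt ρ n μ (y - unitVec μ) x z () () * qAntiAt ρ n l' u' x z () ())
      - w * (qAntiAt ρ n μ y x z () () * qAntiAt ρ n l' u' x z () ())
      = (w * qAntiAt ρ n l' u' x z () ()) * (qAntiAt ρ n μ (y - unitVec μ) x z () () - qAntiAt ρ n μ y x z () ()) := fun μ => by ring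
  simp only [hre, ← Finset.mul_sum, div_qAntiAt_apply n hρ]
  unfold sameBlk
  by_cases hxy : x = y
  · subst hxy
    rw [if_pos rfl, if_pos rfl]
    by_cases hzx : z = x
    · subst hzx
      rw [if_pos rfl, if_pos rfl]
      field_simp
      ring
    · rw [if_neg hzx]
      by_cases hb : blk (n - 1) x = blk (n - 1) z
      · rw [if_pos hb]
        field_simp
        ring
      · rw [if_neg hb, qAntiAt_eq_zero_of_blk_ne ρ n l' u' hb]
        ring
  · rw [if_neg hxy]
    by_cases hzy : z = y
    · subst hzy
      rw [if_pos rfl]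
      by_cases hb : blk (n - 1) x = blk (n - 1) z
      · rw [if_pos hb]
        field_simp
        ring
      · rw [if_neg hb, qAntiAt_eq_zero_of_blk_ne ρ n l' u' hb]
        ring
    · rw [if_neg hzy]
      ring

/-- [our object] **THE COMPLETED TWO-BOND GHOST TABLE** (root `ρ`, blocking `n`, generator weight `x₀`, stencil weights `cK, cQ`):
`WghAt ρ n x₀ cK cQ := diagExt ((x₀·cK) • ghX) + (−(x₀·cQ·n⁴)) • qSqAt ρ n` — T6 v1.1's bond-diagonal kinetic contact (weight `x₀·cK`)
PLUS the averaging square, with exactly the weights that make (W2) hold against `SghAt ρ n cK cQ` and `X u = x₀ • genX u` (`ward₂_WghAt`).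
A DEFINITION; asserts nothing; the identification of the weights with Bałaban's is the owner's CHECK-N0. -/
def WghAt (ρ : Site 4) (n : ℕ) (x₀ cK cQ : ℝ) : Fin 4 → Site 4 → Fin 4 → Site 4 → MKer 4 Unit := fun κ v l v' =>
  diagExt (fun μ y => (x₀ * cK) • ghX μ y) κ v l v' + (-(x₀ * cQ * (n : ℝ) ^ 4)) • qSqAt ρ n κ v l v'

omit [NeZero n] in
/-- [our object] Unfolding `WghAt`. -/
theorem WghAt_eq (x₀ cK cQ : ℝ) (κ : Fin 4) (v : Site 4) (l : Fin 4) (v' : Site 4) :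
    WghAt ρ n x₀ cK cQ κ v l v' = diagExt (fun μ y => (x₀ * cK) • ghX μ y) κ v l v' + (-(x₀ * cQ * (n : ℝ) ^ 4)) • qSqAt ρ n κ v l v' := rfl

/-- [folklore] **(W2) FOR THE COMPLETED GHOST TABLE — ALL WEIGHTS, EVERY IN-BLOCK ROOT**:
`divW (WghAt ρ n x₀ cK cQ) u λ′ u′ = (x₀ • genX u) ∘ SghAt ρ n cK cQ λ′ u′ − SghAt ρ n cK cQ λ′ u′ ∘ (x₀ • genX u)`
(= leaf-01-g3's `ward₂_ghX` for the current part + (W2-Q) for the averaging part, by linearity of `divW`). -/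
theorem ward₂_WghAt {ρ : Site 4} (hρ : ∀ i : Fin 4, 0 ≤ ρ i ∧ ρ i < n) (x₀ cK cQ : ℝ) (y : Site 4) (l' : Fin 4) (u' : Site 4) :
    divW (WghAt ρ n x₀ cK cQ) y l' u'
      = comp (x₀ • genX y) (SghAt ρ n cK cQ l' u') - comp (SghAt ρ n cK cQ l' u') (x₀ • genX y) := by
  have hn : (n : ℝ) ≠ 0 := by exact_mod_cast NeZero.ne n
  have hK := ward₂_ghX l' u' n (x₀ * cK) y
  have hQ := divW_smul_qSqAt n hρ (-(x₀ * cQ * (n : ℝ) ^ 4)) y l' u'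
  funext x z a b
  obtain rfl : a = () := Subsingleton.elim _ _
  obtain rfl : b = () := Subsingleton.elim _ _
  have hK' := congr_fun (congr_fun (congr_fun (congr_fun hK x) z) ()) ()
  have hQ' := congr_fun (congr_fun (congr_fun (congr_fun hQ x) z) ()) ()
  rw [Pi.sub_apply, Pi.sub_apply, Pi.sub_apply, Pi.sub_apply, comp_genX_left, comp_genX_right, Sgh_zero_eq] at hK'
  rw [Pi.smul_apply, Pi.smul_apply, Pi.smul_apply, Pi.smul_apply, smul_eq_mul, Pi.sub_apply, Pi.sub_apply, Pi.sub_apply, Pi.sub_apply,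
    comp_genX_left, comp_genX_right] at hQ'
  rw [show WghAt ρ n x₀ cK cQ = fun κ v l v' => diagExt (fun μ y => (x₀ * cK) • ghX μ y) κ v l v'
      + (fun κ v l v' => (-(x₀ * cQ * (n : ℝ) ^ 4)) • qSqAt ρ n κ v l v') κ v l v' from rfl, divW_add_apply, hK', hQ']
  simp only [Pi.sub_apply, Pi.smul_apply, smul_eq_mul, comp_smul_left', comp_smul_right', comp_genX_left, comp_genX_right, SghAt_apply]
  field_simp
  ring

/-- [folklore] **LOCALISATION SOCKET OF THE COMPLETED TABLE** at the block-structured rate `δ/n` (in-block root, `δ ≥ 0`):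
`BiLoc (WghAt ρ n x₀ cK cQ κ′ u λ′ u′) u u′ (|x₀·cK|·e^{δ/n} + |x₀·cQ·n⁴|·((8/n³)e^{8δ})²) (δ/n)`. -/
theorem biLoc_WghAt {ρ : Site 4} (hρ : ∀ i : Fin 4, 0 ≤ ρ i ∧ ρ i < n) (x₀ cK cQ : ℝ) {δ : ℝ} (hδ : 0 ≤ δ)
    (κ : Fin 4) (v : Site 4) (l : Fin 4) (v' : Site 4) :
    BiLoc (WghAt ρ n x₀ cK cQ κ v l v') v v'
      (|x₀ * cK| * Real.exp (δ / n) + |(-(x₀ * cQ * (n : ℝ) ^ 4))| * (8 / (n : ℝ) ^ 3 * Real.exp (8 * δ)) ^ 2) (δ / n) := by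
  have hT : ∀ μ y, BiLoc ((fun μ y => (x₀ * cK) • ghX μ y) μ y) y y (|x₀ * cK| * Real.exp (δ / n)) (δ / n) :=
    fun μ y => biLoc_smul' (x₀ * cK) (biLoc_ghX μ y (δ / n))
  have h1 := biLoc_diagExt (fun μ y => (x₀ * cK) • ghX μ y) hT (by positivity) κ v l v'
  have h2 := biLoc_smul' (-(x₀ * cQ * (n : ℝ) ^ 4)) (biLoc_qSqAt n κ v l v' hρ hδ)
  exact biLoc_add h1 h2

omit [NeZero n] in
/-- [folklore] BOND-SWAP SYMMETRY of the completed table (the END's `hWsymm`). -/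
theorem WghAt_symm (x₀ cK cQ : ℝ) (κ : Fin 4) (v : Site 4) (l : Fin 4) (v' : Site 4) :
    WghAt ρ n x₀ cK cQ κ v l v' = WghAt ρ n x₀ cK cQ l v' κ v := by
  rw [WghAt_eq, WghAt_eq, diagExt_symm, qSqAt_swap]

omit [NeZero n] in
/-- [folklore] The scaled kinetic contact is translation covariant (every fine vector; `ghX_translate`). -/
theorem ghXTab_translate (c : ℝ) (μ : Fin 4) (y t : Site 4) :
    (fun μ y => c • ghX μ y) μ (y + t) = shiftK (-t) ((fun μ y => c • ghX μ y) μ y) := by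
  simp only [ghX_translate μ y t, shiftK_smul]

/-- [folklore] **BLOCK-TRANSLATION COVARIANCE OF THE COMPLETED TABLE** (the END's `hWcov`). -/
theorem WghAt_translate (x₀ cK cQ : ℝ) (κ : Fin 4) (v : Site 4) (l : Fin 4) (v' t : Site 4) :
    WghAt ρ n x₀ cK cQ κ (v + (n : ℤ) • t) l (v' + (n : ℤ) • t) = shiftK (-((n : ℤ) • t)) (WghAt ρ n x₀ cK cQ κ v l v') := by
  rw [WghAt_eq, WghAt_eq, diagExt_translate (fun μ y => (x₀ * cK) • ghX μ y) (fun s : Site 4 => (n : ℤ) • s)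
    (fun μ y s => ghXTab_translate (x₀ * cK) μ y ((n : ℤ) • s)) κ v l v' t, qSqAt_translate]
  rfl

/-- [folklore] **INVERSION LAW OF THE COMPLETED TABLE AT THE CENTRED ROOT** (odd `n`; the END's `hWr` with `(invLeg n, cInv n, σ ≡ −1)`). -/
theorem WghAt_pointInversion (hodd : Odd n) (x₀ cK cQ : ℝ) (κ : Fin 4) (v : Site 4) (l : Fin 4) (v' : Site 4) :
    WghAt (ctrHalf n) n x₀ cK cQ κ (cInv n κ - v) l (cInv n l - v')
      = ((-1 : ℝ) * (-1)) • refK (invLeg n) (WghAt (ctrHalf n) n x₀ cK cQ κ v l v') := by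
  have hD := diagExt_refl (invLeg n) (T := fun μ y => (x₀ * cK) • ghX μ y) (fun μ y => cInv n μ - y)
    (fun μ y y' h => sub_right_injective h) (fun _ => (-1 : ℝ)) (fun _ => by norm_num)
    (fun μ y => smul_ghX_pointInversion n μ y (x₀ * cK)) κ v l v'
  rw [WghAt_eq, WghAt_eq, hD, qSqAt_pointInversion n κ v l v' hodd, refK_add, refK_smul, smul_add, smul_comm]

/-! ## §3 The ENDs: the ghost-sector Ward rows as a theorem; the moment transfer with no hypothesis -/

/-- [folklore] **THE WARD ROW SUMS `hrow` OF THE COMPLETED GHOST FINE HESSIAN KERNEL ARE A THEOREM** (every in-block root `ρ`, every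
`n ≥ 1`, `0 < a`, every real `c`): for the leg `Ggh n a`, the rooted stencil on the Ward ray `SghAt ρ n (c·n²) (c·a)` and the completed
table `WghAt ρ n (−c) (c·n²) (c·a)`, every entry of `fineHessA` has rows summing to `0` — node A3.b's ghost piece at T6-Q₂ scope
(`FineHessianWard.hasSum_row_fineHessA_of_wardLaws` fed with `ward₁_Ggh_rooted` and `ward₂_WghAt`). -/
theorem hasSum_row_fineHessA_ghost {ρ : Site 4} (hρ : ∀ i : Fin 4, 0 ≤ ρ i ∧ ρ i < n) {a : ℝ} (ha : 0 < a) (c : ℝ)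
    (κ₁ l₁ : Fin 4) (b : Site 4) :
    HasSum (fineHessA (Ggh n a) (SghAt ρ n (c * (n : ℝ) ^ 2) (c * a)) (WghAt ρ n (-c) (c * (n : ℝ) ^ 2) (c * a)) κ₁ l₁ b) 0 := by
  have hn : (0 : ℝ) < 1 / (n : ℝ) := div_pos one_pos (by exact_mod_cast Nat.pos_of_ne_zero (NeZero.ne n))
  exact hasSum_row_fineHessA_of_wardLaws (Ggh n a) (fun y => (-c) • genX y) (spr_Ggh n a ha)
    (fun μ y => biLoc_SghAt n μ y hρ (c * (n : ℝ) ^ 2) (c * a) zero_le_one)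
    (fun μ y l y' => biLoc_WghAt n hρ (-c) (c * (n : ℝ) ^ 2) (c * a) zero_le_one μ y l y')
    (fun y => biLoc_smul_genX c y (1 / n)) hn
    (fun μ y l y' => WghAt_symm ρ n (-c) (c * (n : ℝ) ^ 2) (c * a) μ y l y')
    (fun y => ward₁_Ggh_rooted n hρ ha c y)
    (fun y l y' => ward₂_WghAt n hρ (-c) (c * (n : ℝ) ^ 2) (c * a) y l y') κ₁ l₁ b

/-- [folklore] **A4 / K-R5 FOR THE COMPLETED, CENTRE-ROOTED GHOST FINE KERNEL — NO HYPOTHESIS BEYOND `Odd n`, `0 < a`**: for every real `c`,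
`Σ′_z z_κ z_λ · n⁸ · TOfGh n a (SghAt c₀ n (c·n²) (c·a)) (tableRedF n (WghAt c₀ n (−c) (c·n²) (c·a))) μ ν z = avgM2 n (fineHessA …  μ ν) κ λ`,
`c₀ = ctrHalf n`: the coarse BOND second moment of the dressed ghost kernel is the base-point block average of the fine one (`X_n = 0`).
Ward rows: `hasSum_row_fineHessA_ghost`; parity: `SghAt_pointInversion`, `WghAt_pointInversion`, `refK_invLeg_Ggh`; everything through
`FineHessianWard.bondSecondMoment_TOfLeg_eq_avgM2_of_laws` BY NAME. -/
theorem bondSecondMoment_TOfGh_eq_avgM2_ghost (hodd : Odd n) {a : ℝ} (ha : 0 < a) (c : ℝ) (κ lam μ ν : Fin 4) :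
    ∑' z : Site 4, ((z κ * z lam : ℤ) : ℝ) * ((n : ℝ) ^ 8 *
        TOfGh n a (SghAt (ctrHalf n) n (c * (n : ℝ) ^ 2) (c * a))
          (tableRedF n (WghAt (ctrHalf n) n (-c) (c * (n : ℝ) ^ 2) (c * a))) μ ν z)
      = avgM2 n (fineHessA (Ggh n a) (SghAt (ctrHalf n) n (c * (n : ℝ) ^ 2) (c * a))
          (WghAt (ctrHalf n) n (-c) (c * (n : ℝ) ^ 2) (c * a)) μ ν) κ lam := by
  have hn : (0 : ℝ) < 1 / (n : ℝ) := div_pos one_pos (by exact_mod_cast Nat.pos_of_ne_zero (NeZero.ne n))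
  have hρ := ctrHalf_mem n
  exact bondSecondMoment_TOfLeg_eq_avgM2_of_laws (Ggh n a) n (spr_Ggh n a ha) (shiftK_Ggh_neg n a ha)
    (fun μ y => biLoc_SghAt n μ y hρ (c * (n : ℝ) ^ 2) (c * a) zero_le_one)
    (fun μ y l y' => biLoc_WghAt n hρ (-c) (c * (n : ℝ) ^ 2) (c * a) zero_le_one μ y l y') hn
    (fun μ y t => SghAt_translate_block (ctrHalf n) n (c * (n : ℝ) ^ 2) (c * a) μ y t)
    (fun μ y l y' t => WghAt_translate (ctrHalf n) n (-c) (c * (n : ℝ) ^ 2) (c * a) μ y l y' t)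
    (fun μ y l y' => WghAt_symm (ctrHalf n) n (-c) (c * (n : ℝ) ^ 2) (c * a) μ y l y')
    (fun y => (-c) • genX y) (fun y => biLoc_smul_genX c y (1 / n))
    (fun y => ward₁_Ggh_rooted n hρ ha c y)
    (fun y l y' => ward₂_WghAt n hρ (-c) (c * (n : ℝ) ^ 2) (c * a) y l y')
    (invLeg n) (refK_invLeg_Ggh n a ha) (fun μ => cInv n μ) (fun _ => (-1 : ℝ)) (fun _ _ => by norm_num)
    (fun μ y => SghAt_pointInversion n hodd (c * (n : ℝ) ^ 2) (c * a) μ y)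
    (fun μ y l y' => WghAt_pointInversion n hodd (-c) (c * (n : ℝ) ^ 2) (c * a) μ y l y') κ lam μ ν

end Summit.QuantumFields.BalabanUV.Beta.D1BFx.GhostAveragingSquare

end
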